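import Literature.Geometry.Lorentzian.BackgroundChartCalculusLocal
import Literature.Geometry.Lorentzian.NearMinkowskiChart
import HarnessLib

/-!
# Pointed `Cᵏ_loc` subconvergence from charts that are good on an exhaustion only

Twin of `SpacetimeLocalConvergenceOfCharts.lean` for chart maps `Ψₙ : ↥O → 𝓢ₙ` which are smooth,
injective and `C⁰`-pinched only on the piece over `W n`, where `W 0 ≤ W 1 ≤ ⋯` are preconnected
open subsets of `O` containing the centre and exhausting `O` (time translates of a chart defined
after some time). Since the `n`-th comparison map of a `LocalSubconvergence` datum is only used on
the `n`-th member of the exhaustion of the limit, it suffices to shrink that exhaustion into the good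
pieces: `LocalSubconvergence.ofChartsExhaustion`, `SubconvergesLocallyTo.ofChartsExhaustion`.

## References
* P. Petersen, *Riemannian Geometry*, 2nd ed., GTM 171, Springer 2006, Ch. 10, §3.2. [Petersen2006]
-/

noncomputable section

open Set Filter TopologicalSpace Function
open scoped Manifold ContDiff Topology ENNReal

universe u

namespace Literature.Geometry.Lorentzian

namespace Spacetime

namespace LocalSubconvergence

variable {𝓢ₙ : ℕ → Spacetime.{u} 4} {pₙ : ∀ n, (𝓢ₙ n).carrier} {O : Opens E4}

/-- **The subconvergence datum defined by converging charts good on an exhaustion** (module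
docstring). [cite: Petersen2006, Ch. 10 §3.2] -/
def ofChartsExhaustion (hO : IsConnected (O : Set E4)) {y₀ : E4} (hy₀ : y₀ ∈ (O : Set E4))
    (W : ℕ → Opens E4) (hWO : ∀ n, (W n : Set E4) ⊆ (O : Set E4)) (hWm : Monotone W)
    (hWc : ∀ n, IsPreconnected (W n : Set E4)) (hW0 : y₀ ∈ (W 0 : Set E4))
    (hWU : ∀ y ∈ (O : Set E4), ∃ n, y ∈ (W n : Set E4))
    (Ψ : ∀ n, O → (𝓢ₙ n).carrier)
    (hΨ : ∀ n, ContMDiffOn 𝓘(ℝ, E4) (𝓡 4) ∞ (Ψ n) (Subtype.val ⁻¹' (W n : Set E4)))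
    (hinj : ∀ n, InjOn (Ψ n) (Subtype.val ⁻¹' (W n : Set E4)))
    (hcentre : ∀ n, Ψ n ⟨y₀, hy₀⟩ = pₙ n)
    (hfut : ∀ n, (𝓢ₙ n).timeOrientation.IsFutureDirected
      (mfderiv 𝓘(ℝ, E4) (𝓡 4) (Ψ n) ⟨y₀, hy₀⟩ (E4.basisVector 0)))
    (hpinch : ∀ n, ∀ y ∈ (W n : Set E4),
      ‖(𝓢ₙ n).deviationExtend (Minkowski.backgroundOn O) (Ψ n) y‖ < 1)
    (L : NearMinkowskiChart O) {φ : ℕ → ℕ} (hφ : StrictMono φ) (k : ℕ)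
    (hlim : ∀ K ⊆ (O : Set E4), IsCompact K →
      Tendsto (fun m ↦ supCkENorm K k
        ((𝓢ₙ (φ m)).metricInCoords (Ψ (φ m) ∘ (chartAt E4 (⟨y₀, hy₀⟩ : O)).symm) - L.G))
        atTop (𝓝 0)) :
    LocalSubconvergence 𝓢ₙ pₙ (L.spacetime hO) ⟨y₀, hy₀⟩ k where
  sub := φ
  strictMono_sub := hφ
  U m := ⟨(reflOpens (L.spacetime hO) ⟨y₀, hy₀⟩ m : Set (L.spacetime hO).carrier) ∩
      Subtype.val ⁻¹' (W m : Set E4),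
    (reflOpens (L.spacetime hO) ⟨y₀, hy₀⟩ m).2.inter ((W m).2.preimage continuous_subtype_val)⟩
  monotone_U m m' hmn x hx :=
    ⟨interior_mono ((compactExhaustion (L.spacetime hO)).subset (Nat.add_le_add_right hmn _)) hx.1,
      hWm hmn hx.2⟩
  mem_U := ⟨(compactExhaustion (L.spacetime hO)).subset_interior (by omega)
    ((compactExhaustion (L.spacetime hO)).mem_find _), hW0⟩
  iUnion_U := eq_univ_of_forall fun x ↦ by
    obtain ⟨n, hn⟩ := hWU x.1 x.2
    refine mem_iUnion.2 ⟨max ((compactExhaustion (L.spacetime hO)).find x + 1) n, ?_, ?_⟩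
    · exact (compactExhaustion (L.spacetime hO)).subset_interior (by omega)
        ((compactExhaustion (L.spacetime hO)).mem_find x)
    · exact hWm (le_max_right _ _) hn
  isCompact_closure_U m :=
    ((compactExhaustion (L.spacetime hO)).isCompact _).closure_of_subset
      (inter_subset_left.trans interior_subset)
  embed m := Ψ (φ m)
  isLocalDiffeomorphOn_embed m :=
    (𝓢ₙ (φ m)).isLocalDiffeomorphOn_of_norm_deviationExtend_lt_one_of_contMDiffOn (Ψ (φ m))
      (W (φ m)).2 (hWO _) (hΨ _) (hpinch _) fun x hx ↦ hWm (hφ.id_le m) hx.2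
  injOn_embed m := (hinj (φ m)).mono fun x hx ↦ hWm (hφ.id_le m) hx.2
  embed_basepoint m := hcentre (φ m)
  isFutureDirected_mfderiv_embed m x hx :=
    (𝓢ₙ (φ m)).isFutureDirected_mfderiv_basisVector_zero_of_isPreconnected_of_contMDiffOn (Ψ (φ m))
      (W (φ m)).2 (hWO _) (hΨ _) (hpinch _) (hWc (φ m)) subset_rfl (z₁ := ⟨y₀, hy₀⟩)
      (hWm (Nat.zero_le _) hW0) (hfut (φ m)) x (hWm (hφ.id_le m) hx.2)
  tendsto_supCkENorm x K hK hKt := by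
    have hKO : K ⊆ (O : Set E4) := by
      have h : (chartAt E4 x).target = (O : Set E4) := OpensChart.chartAt_target x
      exact hKt.trans h.subset
    have heq : ∀ m, supCkENorm K k
        ((𝓢ₙ (φ m)).metricInCoords (Ψ (φ m) ∘ (chartAt E4 x).symm) -
          (L.spacetime hO).metricInCoords (chartAt E4 x).symm) =
        supCkENorm K k ((𝓢ₙ (φ m)).metricInCoords (Ψ (φ m) ∘ (chartAt E4 (⟨y₀, hy₀⟩ : O)).symm)
          - L.G) := fun m ↦ by
      refine supCkENorm_congr fun y hy ↦ ?_
      filter_upwards [O.2.mem_nhds (hKO hy)] with z hz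
      have h1 : (L.spacetime hO).metricInCoords (chartAt E4 x).symm z = L.G z :=
        L.metricInCoords_chartAt_symm hO x hz
      show (𝓢ₙ (φ m)).metricInCoords (Ψ (φ m) ∘ (chartAt E4 (⟨y₀, hy₀⟩ : O)).symm) z -
          (L.spacetime hO).metricInCoords (chartAt E4 x).symm z =
        (𝓢ₙ (φ m)).metricInCoords (Ψ (φ m) ∘ (chartAt E4 (⟨y₀, hy₀⟩ : O)).symm) z - L.G z
      rw [h1]
    exact (hlim K hKO hK).congr fun m ↦ (heq m).symm

end LocalSubconvergence

/-- **Pointed `Cᵏ_loc` subconvergence from charts good on an exhaustion** (module docstring).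
[cite: Petersen2006, Ch. 10 §3.2] -/
theorem SubconvergesLocallyTo.ofChartsExhaustion {𝓢ₙ : ℕ → Spacetime.{u} 4}
    {pₙ : ∀ n, (𝓢ₙ n).carrier} {O : Opens E4} (hO : IsConnected (O : Set E4)) {y₀ : E4}
    (hy₀ : y₀ ∈ (O : Set E4)) (W : ℕ → Opens E4) (hWO : ∀ n, (W n : Set E4) ⊆ (O : Set E4))
    (hWm : Monotone W) (hWc : ∀ n, IsPreconnected (W n : Set E4)) (hW0 : y₀ ∈ (W 0 : Set E4))
    (hWU : ∀ y ∈ (O : Set E4), ∃ n, y ∈ (W n : Set E4)) (Ψ : ∀ n, O → (𝓢ₙ n).carrier)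
    (hΨ : ∀ n, ContMDiffOn 𝓘(ℝ, E4) (𝓡 4) ∞ (Ψ n) (Subtype.val ⁻¹' (W n : Set E4)))
    (hinj : ∀ n, InjOn (Ψ n) (Subtype.val ⁻¹' (W n : Set E4)))
    (hcentre : ∀ n, Ψ n ⟨y₀, hy₀⟩ = pₙ n)
    (hfut : ∀ n, (𝓢ₙ n).timeOrientation.IsFutureDirected
      (mfderiv 𝓘(ℝ, E4) (𝓡 4) (Ψ n) ⟨y₀, hy₀⟩ (E4.basisVector 0)))
    (hpinch : ∀ n, ∀ y ∈ (W n : Set E4),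
      ‖(𝓢ₙ n).deviationExtend (Minkowski.backgroundOn O) (Ψ n) y‖ < 1)
    (L : NearMinkowskiChart O) {φ : ℕ → ℕ} (hφ : StrictMono φ) {k : ℕ}
    (hlim : ∀ K ⊆ (O : Set E4), IsCompact K →
      Tendsto (fun m ↦ supCkENorm K k
        ((𝓢ₙ (φ m)).metricInCoords (Ψ (φ m) ∘ (chartAt E4 (⟨y₀, hy₀⟩ : O)).symm) - L.G))
        atTop (𝓝 0)) :
    SubconvergesLocallyTo 𝓢ₙ pₙ (L.spacetime hO) ⟨y₀, hy₀⟩ k :=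
  ⟨LocalSubconvergence.ofChartsExhaustion hO hy₀ W hWO hWm hWc hW0 hWU Ψ hΨ hinj hcentre hfut hpinch L
    hφ k hlim⟩

end Spacetime

end Literature.Geometry.Lorentzian

end
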